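import Summits.KontsevichZagierPeriods.KontsevichZagierPeriods.Theses.FurushoPentagon
import Literature.NumberTheory.Transcendental.KZCubicalCalculus
import Literature.NumberTheory.Transcendental.AyoubPeriodSeries
import Literature.NumberTheory.Transcendental.KZKernelConjectureForms

/-!
# Sketch — crux `SectorToKernel` (stmt-KontsevichZagierPeriods-10813), idea `effective-cube-surjection`

Planner scratch file (crux-ideate round 1, ideator 1). Nothing here is proposed to the gate.

§0  Structural facts about the crux (all proved below, no sorry):
    * the crux is `StuffleInKZ → HoffmanRelationInKZ → KZKernelConjecture` by `Iff.rfl`;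
    * the kernel conjecture alone implies it (the two hypotheses are decorative);
    * the summit statement implies it (`kzKernelConjecture_iff_isRational`), so the crux is
      summit-equivalent modulo its hypotheses — every line is a conditional bridge.
§1  The line's typed pieces (Props only; they ELABORATE, nothing is asserted):
    * `CubeCompilation`      — L1, the rules-side first lemma (surjectivity of the cube map Φ′);
    * `StokesCubeCalibration` — Φ′ kills Ayoub's Stokes elements (a NL move along any coordinate);
    * `AyoubEffectiveCubeKernel` — the bridgehead: Ayoub, Ann. of Math. 181 (2015) Conj. 1.1 over
      `k = ℚ`, typed over the tree's `AyoubRel.Oan / intC / relAC / kSpan`;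
    * `LineA` — the composition the crux-plan skeleton has to prove.
-/

open Literature.NumberTheory.Transcendental
open Summit.KontsevichZagierPeriods.KontsevichZagierPeriods.Theses.FurushoPentagon

namespace Summit.KontsevichZagierPeriods.KontsevichZagierPeriods.Cruxes.SectorToKernel.EffectiveCubeSurjection

/-! ### §0 What the crux is -/

theorem sectorToKernel_iff :
    SectorToKernel ↔ (StuffleInKZ → HoffmanRelationInKZ → KZKernelConjecture) := Iff.rfl

/-- The hypotheses are decorative: the kernel form alone gives the crux. -/
theorem sectorToKernel_of_kernel (h : KZKernelConjecture) : SectorToKernel := fun _ _ => h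

/-- The summit statement gives the crux (proved equivalence of the kernel and KZ-literal forms). -/
theorem sectorToKernel_of_summit (h : _root_.KontsevichZagierPeriods) : SectorToKernel :=
  sectorToKernel_of_kernel (kzKernelConjecture_iff_isRational.mpr h)

/-- Conversely the crux plus its two hypotheses give the kernel form (and hence the summit, `closes`). -/
theorem kernel_of_sectorToKernel (h : SectorToKernel) (hS : StuffleInKZ) (hH : HoffmanRelationInKZ) :
    KZKernelConjecture := h hS hH

/-! ### §1 The line `effective-cube-surjection` -/

/-- **L1 — CubeCompilation (first lemma, rules-side, theorem-grade).** Every integral representation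
is KZ-equivalent to ONE cube representation `[[0,1]^m, g]` whose integrand is the sum on the closed
cube of a real power series with polyradius of convergence `> 1` and is algebraic over `ℚ(z)` —
i.e. `g` is (the restriction of) a real element of Ayoub's `𝒪_{ℚ-alg}(𝔻̄^m)`. Intended proof:
semi-canonical reduction to `±vol(K)` / suspension, embedded rectilinearisation of the pair
(integrand, ∂K) run as moves (1a)+(2) (blow-ups are injective off null sets, power substitutions
are injective on orthants), then dyadic subdivision + affine rescaling (`KZ.cubicalSubdivGens`)
until every piece extends to a complex polydisc of radius `> 1`, then integrand additivity to
re-sum the pieces on one cube. -/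
def CubeCompilation : Prop :=
  ∀ {n : ℕ} (r : KZ.IntegralRep n), ∃ (m : ℕ) (s : KZ.IntegralRep m) (F : MvPowerSeries (Fin m) ℝ) (ρ : ℝ),
    1 < ρ ∧ s.domain = KZ.cube m ∧
    Summable (fun a : Fin m →₀ ℕ => |MvPowerSeries.coeff a F| * ρ ^ (a.sum fun _ k => k)) ∧
    (∀ x ∈ KZ.cube m,
      HasSum (fun a : Fin m →₀ ℕ => MvPowerSeries.coeff a F * a.prod (fun i k => x i ^ k)) (s.integrand x)) ∧
    (∃ P : Polynomial (MvPolynomial (Fin m) ℚ), P ≠ 0 ∧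
      ∀ x ∈ KZ.cube m, Polynomial.eval₂ (MvPolynomial.aeval x : MvPolynomial (Fin m) ℚ →ₐ[ℚ] ℝ).toRingHom
        (s.integrand x) P = 0) ∧
    KZ.Equivalent r s

/-- **StokesCubeCalibration.** Ayoub's Stokes element along ANY coordinate `i` of the cube is a
KZ relation: for `H` analytic near `[0,1]^{m+1}` and `ℚ`-semialgebraic on it, the cube
representation with integrand `∂ᵢH − H|_{xᵢ=1} + H|_{xᵢ=0}` (the restrictions read as functions of
all `m+1` variables, constant in `xᵢ`) lies in `KZ.relations` (coordinate transposition = rule (2),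
Newton–Leibniz along the last coordinate = rule (3), re-inflation of the restrictions by a slab,
integrand additivity). Same content as route AyoubSpecialisation's support `AyoubRelACubeCalibration`,
here over tame-cube data. -/
def StokesCubeCalibration : Prop :=
  ∀ {m : ℕ} (i : Fin (m + 1)) (H : (Fin (m + 1) → ℝ) → ℝ) (r : KZ.IntegralRep (m + 1)),
    AnalyticOnNhd ℝ H (KZ.cube (m + 1)) → IsSemialgebraicFunOn ℚ (KZ.cube (m + 1)) H →
    r.domain = KZ.cube (m + 1) →
    (∀ x ∈ KZ.cube (m + 1),
      r.integrand x = fderiv ℝ H x (Pi.single i 1) - H (Function.update x i 1) + H (Function.update x i 0)) →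
    KZ.of r ∈ KZ.relations

/-- **The bridgehead — Ayoub's EFFECTIVE cube conjecture** (J. Ayoub, *Une version relative de la
conjecture des périodes de Kontsevich–Zagier*, Ann. of Math. 181 (2015), Conj. 1.1), instance
`k = ℚ`: the kernel of `∫_{[0,1]^∞}` on `𝒪_{ℚ-alg}(𝔻̄^∞)` is the `ℚ`-span of the Stokes elements
`∂G/∂zᵢ − G|_{zᵢ=1} + G|_{zᵢ=0}`. OPEN (period-conjecture strength); typed over the tree's honest
definitions `AyoubRel.Oan`, `AyoubRel.intC`, `AyoubRel.relAC`, `AyoubRel.kSpan`. -/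
def AyoubEffectiveCubeKernel : Prop :=
  ∀ F ∈ AyoubRel.Oan (Rat.castHom ℂ), AyoubRel.intC F = 0 →
    F ∈ AyoubRel.kSpan (Rat.castHom ℂ)
      {x : AyoubRel.CSeries | ∃ G ∈ AyoubRel.Oan (Rat.castHom ℂ), ∃ i : ℕ, x = AyoubRel.relAC i G}

/-- The line, as the implication a crux-plan skeleton must prove (`IntegerDivision` is the route's
own support item 3934, reported PROVED in the disprover's file of crux 3929). The proof is
bookkeeping: pad variables, take real parts (the Stokes operator commutes with coefficientwise
complex conjugation and the span has RATIONAL coefficients), clear denominators, integrand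
additivity + slabs, calibration, integer division. -/
def LineA : Prop :=
  CubeCompilation → StokesCubeCalibration → AyoubEffectiveCubeKernel → IntegerDivision → SectorToKernel

example : LineA = (CubeCompilation → StokesCubeCalibration → AyoubEffectiveCubeKernel →
    IntegerDivision → SectorToKernel) := rfl

end Summit.KontsevichZagierPeriods.KontsevichZagierPeriods.Cruxes.SectorToKernel.EffectiveCubeSurjection
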